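import Summits.HodgeConjecture.HodgeConjecture.Theorems.LimitExtensionHypersurfaceHodgeFourLowDegreeOfComplexOrientation
import Literature.AlgebraicGeometry.HodgeTheory.TopHodgeClassesSpannedByPullbacksFact

/-!
# Route LimitExtension — `HypersurfaceHodgeFourLowDegree` (item stmt-HodgeConjecture-3003), XI:
# Voisin's Lemma 9.18 for the complex orientations PROVED on `ℙ^{d+1}` and REDUCED to the spanning of the
# top rational Hodge classes — the item from Fulton's Lemma 19.1.2 and hard Lefschetz + Lefschetz `(1,1)`

Helper file for the support item `HypersurfaceHodgeFourLowDegree` of route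
`HodgeConjecture/LimitExtension` (`∀ d ≤ 5, ∀ X, IsSmoothHypersurface 4 d X → HodgeConjectureFor 4 X`).
File X (`…OfComplexOrientation`) left the item granted exactly the two named facts
`Fulton1998_degreeFormula_complexOrientation` (Fulton, Lemma 19.1.2) and
`Voisin2003_cycleClass_div_eq_zero_complexOrientation` (Voisin II, Lemma 9.18: `[div φ] = 0`).

Lemma 9.18 is now PROVED through the Hodge index theorem, granted the degree formula and the spanning
of the rational `(d,d)`-classes of `(d+1)`-folds by pull-backs from `ℙ^{d+1}` — all in
`Literature/AlgebraicGeometry/HodgeTheory/`: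

* `CycleClassVanishingOfHodgePairing` — a rational `(1,1)`-class pairing to zero with every rational
  `(m-1,m-1)`-class vanishes (hard Lefschetz / Hodge–Riemann, theorems of the tree);
* `CycleClassDivEqZeroOfSmooth` — reduction to a smooth projective ambient `(d+1)`-fold by
  desingularisation (Hironaka, Fulton Prop. 1.4 (b));
* `CycleClassPrincipalDivisorOfProjectiveSpace` — `[div φ]` is rational of type `(1,1)` and pairs to zero
  with every `F^* u`, `F : T ⟶ ℙ^{d+1}`, granted Lemma 9.18 ON `ℙ^{d+1}` (transposition `F_*`, `[F_* Z] = F_*[Z]`);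
* `PuncturedVarietyHomology`, `ProjectionFromVertexHomology`, `CycleClassPrincipalDivisorOffVertex`,
  `CycleClassPrincipalDivisorProjectiveSpaceHolds` — **Lemma 9.18 on `ℙ^{d+1}` PROVED from the degree
  formula**: blow up the vertex (de Jong 1996, proof of 4.11), `b_* div b^♯ψ = div ψ` and `q_* div b^♯ψ = 0`
  (Fulton Prop. 1.4), and the projection from the vertex is one-to-one on `H_{2d}((ℙ^{d+1} ∖ vertex)(ℂ))`;
* `TopHodgeClassesSpannedByPullbacksFact` — the spanning statement as the NAMED FACT
  `topHodgeClasses_spanned_by_pullbacks` (hard Lefschetz, Voisin I Thm. 6.25, with Lefschetz `(1,1)`,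
  Thm. 11.30 / Cor. 11.34, very-ample generation and generic projections), and
  `Voisin2003_cycleClass_div_eq_zero_complexOrientation_of_degreeFormula_of_spanning`.

Hence `limitExtension_hypersurfaceHodgeFourLowDegree_of_degreeFormula_of_spanning` — **the item from the
named facts `Fulton1998_degreeFormula_complexOrientation` and `topHodgeClasses_spanned_by_pullbacks`
ALONE** (conditional result): Voisin's Lemma 9.18 has left the item's residue on the trust base,
replaced by a consequence of hard Lefschetz and the Lefschetz `(1,1)` theorem, both theorems of the tree
in other forms.

No `sorry`, no definition, no new named fact in this file.

## References

* [Fulton1998] W. Fulton, Intersection Theory, 2nd ed. (1998), Prop. 1.4, Lemma 19.1.2, §19.1.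
* [VoisinHodgeII2003] C. Voisin, Hodge Theory and Complex Algebraic Geometry II (CUP 2003), Lemma 9.18,
  Prop. 9.21 (ii), Prop. 10.26.
* [VoisinHodgeI2002] C. Voisin, Hodge Theory and Complex Algebraic Geometry I (CUP 2002), Thm. 6.25,
  Thm. 11.30, Cor. 11.34.
* [DeJong1996] A. J. de Jong, Smoothness, semi-stability and alterations, Publ. Math. IHÉS 83 (1996),
  proof of Lemma 4.11.
-/

-- `Summit.HodgeConjecture.HodgeConjecture.Theorems` is the mandated namespace (single-problem summit:
-- Problem = Summit), which `linter.dupNamespace` flags on every declaration; the lakefile turns the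
-- linter off tree-wide (weak option), restated here so stand-alone elaboration is warning-free too.
set_option linter.dupNamespace false

noncomputable section

namespace Summit.HodgeConjecture.HodgeConjecture.Theorems

open CategoryTheory AlgebraicGeometry
open Literature.AlgebraicGeometry.HodgeTheory Literature.AlgebraicGeometry.Motives

/-- **`HypersurfaceHodgeFourLowDegree` from Fulton's Lemma 19.1.2 and the spanning of the top rational
Hodge classes by pull-backs from `ℙ^{d+1}` ALONE.** The Hodge conjecture holds for every smooth
hypersurface fourfold of degree `d ≤ 5`, granted the named facts `Fulton1998_degreeFormula_complexOrientation`
(`g_* 1_V = deg • τ_* 1` for the complex orientations) and `topHodgeClasses_spanned_by_pullbacks` (hard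
Lefschetz with Lefschetz `(1,1)`): Voisin's Lemma 9.18 for the complex orientations follows from them
(`Voisin2003_cycleClass_div_eq_zero_complexOrientation_of_degreeFormula_of_spanning`), and the item follows
from the degree formula and Lemma 9.18 (`limitExtension_hypersurfaceHodgeFourLowDegree_of_complexOrientation`,
file X). [cite: Fulton1998, Lemma 19.1.2] [cite: VoisinHodgeII2003, Lemma 9.18 and Prop. 10.26]
[cite: VoisinHodgeI2002, Thm. 6.25 and Thm. 11.30] -/
theorem limitExtension_hypersurfaceHodgeFourLowDegree_of_degreeFormula_of_spanning
    (hB : Fulton1998_degreeFormula_complexOrientation) (hS : topHodgeClasses_spanned_by_pullbacks) :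
    Theses.LimitExtension.HypersurfaceHodgeFourLowDegree :=
  limitExtension_hypersurfaceHodgeFourLowDegree_of_complexOrientation hB
    (Voisin2003_cycleClass_div_eq_zero_complexOrientation_of_degreeFormula_of_spanning hB hS)

/-- **Voisin II, Prop. 10.26 (Bloch–Srinivas) from the same two named facts**: for every smooth projective
complex fourfold with `CH₀` supported in dimension `≤ 3`, every rational `(2,2)`-class is algebraic.
[cite: VoisinHodgeII2003, Prop. 10.26 and its proof (§10.2.3, p. 306)] -/
theorem limitExtension_blochSrinivas_of_degreeFormula_of_spanning
    (hB : Fulton1998_degreeFormula_complexOrientation) (hS : topHodgeClasses_spanned_by_pullbacks) :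
    Literature.Barriers.HodgeConjecture.BlochSrinivas1983_hodgeConjectureDegreeFour_of_chowZeroSupported :=
  limitExtension_blochSrinivas_of_complexOrientation hB
    (Voisin2003_cycleClass_div_eq_zero_complexOrientation_of_degreeFormula_of_spanning hB hS)

end Summit.HodgeConjecture.HodgeConjecture.Theorems

end
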